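import Literature.NumberTheory.LFunctions.ZeroCountingConreyProofs
import Mathlib.NumberTheory.ArithmeticFunction.Moebius
import HarnessLib

/-!
# Conrey's mollifier `B(s, P)` as an admissible Dirichlet-polynomial family

Topic `Literature/NumberTheory/LFunctions`. One definition with a body and PROVED bookkeeping; no
named facts.

J. B. Conrey, *More than two fifths of the zeros of the Riemann zeta function are on the critical
line*, J. reine angew. Math. **399** (1989), 1–26, mollifies `V(s) = Q(−L⁻¹ d/ds) ζ(s)` with

  `B(s, P) = Σ_{n ≤ y} b(n, P) n^{σ₀ − 1/2 − s}`,  `b(n, P) = μ(n) P(log(y/n)/log y)`   ((1), (33)),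

`y = T^θ` ((34); eventually `θ = 4/7 − ε`), `σ₀ = 1/2 − R/L`, `L = log T` ((36)), `P(0) = 0`,
`P(1) = 1`. The file `ZeroCountingConreyProofs.lean` reduces the named fact
`Literature.NumberTheory.LFunctions.conrey_bound` (`κ ≥ 0.4088`, Conrey's Note added in proof) to
Conrey's mean value theorem (Theorem 2) for *some* admissible Dirichlet-polynomial mollifier family
(`Literature.NumberTheory.LFunctions.conrey_bound_of_conrey1989_meanValue`, with the numerics
`conrey1989_numerics` verified there). Here we record that Conrey's own `B(s, P)` is such a family,
so that the one remaining analytic input is literally Theorem 2 (run for the tree's exact variant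
`conreyV` of `V`) for the printed `B`, `P = conrey1989P`, `Q = conrey1989Q`, `R = 1.28`,
`θ = conrey1989Theta = 0.5714 < 4/7`:

* `conreyMollifierCoeff P θ R T n` — the coefficient `a_T(n) = μ(n) P(log(y/n)/log y) n^{−R/L}` of
  `B(σ₀ + it) = Σ_{n ≤ ⌊y⌋} a_T(n) n^{−(σ₀ + it)}` (DEFINITION; guarded to `1 < T`, `n ≤ ⌊y⌋`, and
  `a_T(1) = 1` outright — the printed value since `μ(1) = P(1) = 1`, `conreyMollifierCoeff_eq`);
* `norm_conreyMollifierCoeff_le` — `|a_T(n)| ≤ max(1, Σ_i |coeff_i P|)` for all `T`, `n`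
  (`|μ| ≤ 1`, `log(y/n)/log y ∈ [0, 1]` for `1 ≤ n ≤ y`, `n^{−R/L} ≤ 1`), via
  `abs_eval_le_sum_abs_coeff`; `eventually_one_le_natFloor_rpow` — `1 ≤ ⌊T^θ⌋ ≤ T^θ` eventually;
* `conrey_bound_of_conrey1989_meanValue_mollifier` — **`conrey_bound` from Theorem 2 for Conrey's
  own data**: if for every `ε > 0`, eventually
  `∫_T^{2T} |B(σ₀+it, P) · conreyV Q L (σ₀+it)|² dt ≤ (c(P, Q, R, θ) + ε) T` with
  `c = conrey1989Const`, then `0.4088 ≤ κ`.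

What is NOT here: Theorem 2 itself (§§5–8 of the paper: Balasubramanian–Conrey–Heath-Brown 1985 and
the Deshouillers–Iwaniec estimates for averages of Kloosterman sums, Lemma 9), which is not in
Mathlib or in this tree.

## References

* J. B. Conrey, J. reine angew. Math. 399 (1989), 1–26: (1), (33)–(39), Thm 2, Note added in
  proof (p. 25). [Conrey1989]
-/

noncomputable section

open Complex Polynomial Set Filter MeasureTheory intervalIntegral
open scoped Real

namespace Literature.NumberTheory.LFunctions

/-! ### The coefficients of `B(s, P)` -/

/-- **The coefficients of Conrey's mollifier** `B(s, P) = Σ_{n ≤ y} b(n, P) n^{σ₀ − 1/2 − s}`,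
`b(n, P) = μ(n) P(log(y/n)/log y)`, `y = T^θ`, `σ₀ = 1/2 − R/L`, `L = log T` (Conrey 1989, (1), (33),
(34), (36)), arranged as `B(σ₀ + it) = Σ_n a_T(n) n^{−(σ₀ + it)}` with
`a_T(n) = μ(n) P(log(y/n)/log y) n^{−R/L}`. The definition is guarded: it is this value for `1 < T`
and `n ≤ ⌊y⌋` (the range of the sum), `0` otherwise, and `a_T(1) = 1` outright — the printed value,
since `μ(1) = 1`, `P(1) = 1` (`conreyMollifierCoeff_eq`). [cite: Conrey1989, (1), (33)–(36)] -/
def conreyMollifierCoeff (P : ℝ[X]) (θ R T : ℝ) (n : ℕ) : ℂ :=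
  if n = 1 then 1
  else if 1 < T ∧ n ≤ ⌊T ^ θ⌋₊ then
    (((ArithmeticFunction.moebius n : ℤ) : ℝ) * P.eval (Real.log (T ^ θ / n) / Real.log (T ^ θ)) *
        (n : ℝ) ^ (-(R / Real.log T)) : ℝ)
  else 0

/-- `a_T(1) = 1`. [cite: Conrey1989, (33)] -/
theorem conreyMollifierCoeff_one (P : ℝ[X]) (θ R T : ℝ) : conreyMollifierCoeff P θ R T 1 = 1 := by
  simp [conreyMollifierCoeff]

/-- For `1 < T`, `0 < θ`, `P(1) = 1` and `1 ≤ n ≤ ⌊T^θ⌋`, the guarded definition is the printed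
coefficient `μ(n) P(log(y/n)/log y) n^{−R/log T}` (at `n = 1` this is `μ(1) P(1) = 1`).
[cite: Conrey1989, (1), (33)] -/
theorem conreyMollifierCoeff_eq (P : ℝ[X]) {θ R T : ℝ} (hT : 1 < T) (hθ : 0 < θ) (hP1 : P.eval 1 = 1)
    {n : ℕ} (hn1 : 1 ≤ n) (hn : n ≤ ⌊T ^ θ⌋₊) :
    conreyMollifierCoeff P θ R T n =
      (((ArithmeticFunction.moebius n : ℤ) : ℝ) * P.eval (Real.log (T ^ θ / n) / Real.log (T ^ θ)) *
        (n : ℝ) ^ (-(R / Real.log T)) : ℝ) := by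
  unfold conreyMollifierCoeff
  split_ifs with h1 h2
  · subst h1
    have hy1 : 1 < T ^ θ := Real.one_lt_rpow hT hθ
    have hlog : Real.log (T ^ θ) ≠ 0 := (Real.log_pos hy1).ne'
    simp [div_self hlog, hP1]
  · rfl
  · exact absurd ⟨hT, hn⟩ h2

/-- `|P(x)| ≤ Σ_i |coeff_i P|` for `0 ≤ x ≤ 1`. [folklore] -/
theorem abs_eval_le_sum_abs_coeff (P : ℝ[X]) {x : ℝ} (hx0 : 0 ≤ x) (hx1 : x ≤ 1) :
    |P.eval x| ≤ ∑ i ∈ Finset.range (P.natDegree + 1), |P.coeff i| := by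
  rw [eval_eq_sum_range]
  refine (Finset.abs_sum_le_sum_abs _ _).trans (Finset.sum_le_sum fun i _ ↦ ?_)
  rw [abs_mul, abs_pow, abs_of_nonneg hx0]
  exact mul_le_of_le_one_right (abs_nonneg _) (pow_le_one₀ hx0 hx1)

/-- **`|a_T(n)| ≤ max(1, Σ_i |coeff_i P|)`** for all `T` and `n` (for `2 ≤ n ≤ y = T^θ`, `1 < T`:
`|μ(n)| ≤ 1`, `log(y/n)/log y ∈ [0, 1]`, and `n^{−R/log T} ≤ 1`). [cite: Conrey1989, (1), (33)] -/
theorem norm_conreyMollifierCoeff_le (P : ℝ[X]) {θ R : ℝ} (hθ : 0 < θ) (hR : 0 ≤ R) (T : ℝ) (n : ℕ) :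
    ‖conreyMollifierCoeff P θ R T n‖ ≤ max 1 (∑ i ∈ Finset.range (P.natDegree + 1), |P.coeff i|) := by
  unfold conreyMollifierCoeff
  split_ifs with h1 h2
  · simp
  · obtain ⟨hT, hn⟩ := h2
    rcases Nat.eq_zero_or_pos n with rfl | hn0
    · simp
    have hT0 : 0 < T := by linarith
    have hy0 : 0 < T ^ θ := Real.rpow_pos_of_pos hT0 θ
    have hny : (n : ℝ) ≤ T ^ θ := (Nat.le_floor_iff hy0.le).1 hn
    have hn0' : (0 : ℝ) < n := by exact_mod_cast hn0
    have hn1' : (1 : ℝ) ≤ n := by exact_mod_cast hn0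
    have hlogT : 0 < Real.log T := Real.log_pos hT
    have hlogy : 0 < Real.log (T ^ θ) := by
      rw [Real.log_rpow hT0 θ]; positivity
    set x : ℝ := Real.log (T ^ θ / n) / Real.log (T ^ θ) with hx
    have hx0 : 0 ≤ x := div_nonneg (Real.log_nonneg ((one_le_div hn0').2 hny)) hlogy.le
    have hx1 : x ≤ 1 := by
      rw [hx, div_le_one hlogy, Real.log_div hy0.ne' hn0'.ne']
      have : 0 ≤ Real.log n := Real.log_nonneg hn1'
      linarith
    have hμ : |((ArithmeticFunction.moebius n : ℤ) : ℝ)| ≤ 1 := by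
      rw [← Int.cast_abs]
      exact_mod_cast ArithmeticFunction.abs_moebius_le_one
    have hP := abs_eval_le_sum_abs_coeff P hx0 hx1
    have hr : |(n : ℝ) ^ (-(R / Real.log T))| ≤ 1 := by
      rw [abs_of_nonneg (Real.rpow_nonneg hn0'.le _)]
      refine Real.rpow_le_one_of_one_le_of_nonpos hn1' ?_
      have : 0 ≤ R / Real.log T := div_nonneg hR hlogT.le
      linarith
    rw [Complex.norm_real, Real.norm_eq_abs, abs_mul, abs_mul]
    calc |((ArithmeticFunction.moebius n : ℤ) : ℝ)| * |P.eval x| * |(n : ℝ) ^ (-(R / Real.log T))|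
        ≤ 1 * (∑ i ∈ Finset.range (P.natDegree + 1), |P.coeff i|) * 1 :=
          mul_le_mul (mul_le_mul hμ hP (abs_nonneg _) zero_le_one) hr (abs_nonneg _)
            (by positivity)
      _ = ∑ i ∈ Finset.range (P.natDegree + 1), |P.coeff i| := by ring
      _ ≤ _ := le_max_right _ _
  · simp

/-- For `0 < θ`, eventually `1 ≤ ⌊T^θ⌋ ≤ T^θ` (the length `N_T = ⌊y⌋` of `B`). [folklore] -/
theorem eventually_one_le_natFloor_rpow {θ : ℝ} (hθ : 0 < θ) :
    ∀ᶠ T : ℝ in atTop, 1 ≤ ⌊T ^ θ⌋₊ ∧ ((⌊T ^ θ⌋₊ : ℕ) : ℝ) ≤ T ^ θ := by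
  filter_upwards [eventually_ge_atTop (1 : ℝ)] with T hT
  have h1 : (1 : ℝ) ≤ T ^ θ := Real.one_le_rpow hT hθ.le
  exact ⟨Nat.le_floor (by exact_mod_cast h1), Nat.floor_le (by positivity)⟩

/-- **Conrey's `B(s, P)` is an admissible mollifier family** for the tree's Levinson framework
(`dirichletPolynomial_mollifier_conditions`): with `N_T = ⌊T^θ⌋`, `A = max(1, Σ|coeff P|)`, `κ = 0`,
for `0 < θ`, `0 ≤ R`. [cite: Conrey1989, (33)–(34)] -/
theorem conreyMollifier_admissible (P : ℝ[X]) {θ R : ℝ} (hθ : 0 < θ) (hR : 0 ≤ R) :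
    (∀ᶠ T : ℝ in atTop, 1 ≤ ⌊T ^ θ⌋₊ ∧ ((⌊T ^ θ⌋₊ : ℕ) : ℝ) ≤ T ^ θ) ∧
    (∀ T : ℝ, ∀ n : ℕ, ‖conreyMollifierCoeff P θ R T n‖ ≤
      max 1 (∑ i ∈ Finset.range (P.natDegree + 1), |P.coeff i|) * (n : ℝ) ^ (0 : ℝ)) ∧
    (∀ T : ℝ, conreyMollifierCoeff P θ R T 1 = 1) :=
  ⟨eventually_one_le_natFloor_rpow hθ,
    fun T n ↦ by simpa using norm_conreyMollifierCoeff_le P hθ hR T n,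
    conreyMollifierCoeff_one P θ R⟩

/-! ### `conrey_bound` from Theorem 2 for Conrey's own data -/

/-- **`conrey_bound` (`κ ≥ 0.4088`) from Conrey's Theorem 2 for his own mollifier.** If for every
`ε > 0`, for all large `T`,
`∫_T^{2T} |B(σ₀+it, P) · V(σ₀+it)|² dt ≤ (c(P, Q, R, θ) + ε) T`
with Conrey's `B(s, P)` (`conreyMollifierCoeff`, length `y = T^θ`), `P = conrey1989P`,
`Q = conrey1989Q` (Note added in proof), `R = 1.28`, `θ = conrey1989Theta = 0.5714 < 4/7`,
`σ₀ = 1/2 − R/log T`, `V = conreyV conrey1989Q (log T)` and `c = conrey1989Const` the printed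
constant of Theorem 2 — i.e. Theorem 2 of Conrey 1989 (p. 8, `θ < 4/7`) for these data, run for the
tree's exact-identity variant `conreyV` of `V = Q(−L⁻¹d/ds)ζ` and over dyadic ranges — then
`Literature.NumberTheory.LFunctions.conrey_bound`. (By `conrey_bound_of_conrey1989_meanValue`, the
verified numerics `conrey1989_numerics`, and `conreyMollifier_admissible`.)
[cite: Conrey1989, Thm 2 (p. 8), (39), Note added in proof (p. 25)] -/
theorem conrey_bound_of_conrey1989_meanValue_mollifier
    (hms : ∀ ε > 0, ∀ᶠ T : ℝ in atTop,
      ∫ t in T..2 * T, ‖(∑ n ∈ Finset.Icc 1 ⌊T ^ conrey1989Theta⌋₊,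
          conreyMollifierCoeff conrey1989P conrey1989Theta (32 / 25) T n *
            (n : ℂ) ^ (-((((1 / 2 - (32 / 25) / Real.log T : ℝ)) : ℂ) + t * I))) *
        conreyV conrey1989Q (Real.log T) (((1 / 2 - (32 / 25) / Real.log T : ℝ) : ℂ) + t * I)‖ ^ 2 ≤
        (conrey1989Const + ε) * T) :
    conrey_bound := by
  obtain ⟨hN, ha, ha1⟩ := conreyMollifier_admissible conrey1989P conrey1989Theta_pos_lt.1
    (by norm_num : (0 : ℝ) ≤ 32 / 25)
  exact conrey_bound_of_conrey1989_meanValue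
    (conreyMollifierCoeff conrey1989P conrey1989Theta (32 / 25)) (fun T ↦ ⌊T ^ conrey1989Theta⌋₊)
    (le_trans zero_le_one (le_max_left _ _)) le_rfl hN ha ha1 hms

end Literature.NumberTheory.LFunctions

end
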